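import Summits.ResolutionOfSingularities.ResolutionOfSingularities.Theorems.EquisingularLiftEquisingularLiftNatDeltaCriterion
import Mathlib
import HarnessLib

/-!
# [OURS · L1 W4.5(b)] The Δ-CRITERION at ring level (2/2) — GENERIC LIFTS `g + c·ϖ·h`: at most one bad residue
# per singular point of the trace (crux `EquisingularLiftNat` = stmt-ResolutionOfSingularities-20038, line `sections`)

NOT a statement of any manuscript. Helper file of the chain res-L1-w45b (cell `res-hironaka`, rung L, slot
W4.5(b)); AI-written, weaker than expert review; filed `--supports stmt-ResolutionOfSingularities-20038 --as helper`.
Continuation of `…Theorems.EquisingularLiftEquisingularLiftNatDeltaCriterion` (Δ1/Δ2: order-one criterion; a Δ-curve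
is regular wherever its reduced trace is regular, for every lift). Here the second half of the Δ-criterion, at the
SINGULAR points of the trace, refining D1 (iii) `deltaRegularGeneric` (p502482: `σ = Fin 2`, `f = g + uϖ`) to lifts
`g + c·ϖ·h` with a MULTIPLIER `h` (as the dehomogenisations `ϖ·M(T)|_{T_j = 1}` of a projective lift
`G + c·ϖ·M ∈ O[T₀, T₁, T₂]_d` carry) and to any finite index type `σ`.

THEOREMS (`O` a DVR with uniformizer `ϖ`, `k = O/ϖ`, `A = MvPolynomial σ O`, `g h ∈ A`):
* (Δ3) `subsingleton_badResidue` — for a prime `P ∋ ϖ` of `A` with `h ∉ P`: at most ONE residue class `c̄ ∈ k` has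
  `g + c·ϖ·h ∈ 𝔪_P²` (two of them would put `ϖ` in `𝔪_P²`, but `A_P/(ϖ) ≅ k[x_σ]_𝔮` is regular).
* (Δ4) `deltaRegularGeneric_mul` — if the primes `𝔮 ∋ ḡ` of `k[x_σ]` with `ḡ ∈ 𝔪_𝔮²` (the non-regular points of
  the trace `D = V(ḡ)`) are finitely many and `h̄` vanishes at none of them, then for all `c ∈ O` off finitely many
  residue classes the Δ-curve `A/(g + c·ϖ·h)` is a regular local ring at every prime containing `ϖ`;
  `deltaRegularGeneric_mul_fin_two`: for `σ = Fin 2` and `ḡ ≠ 0` squarefree the finiteness is automatic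
  (`finite_setOf_mem_sq`, p501885) — `deltaRegularGeneric` is the case `h = 1`.

References: H. Matsumura, *Commutative Ring Theory* (1986), Thm. 14.2. res-L1-w45b-lead-2 TARGETS (2) «(ii) V(C)
regular iff the Δ-criterion at every special point» and res-type-100 SIGNATURE T-CARRIER-Δ (OURS planning texts,
index only).
-/

set_option linter.dupNamespace false -- mandated namespace `Summit.<Summit>.<Problem>` of this single-conjunct summit
set_option linter.overlappingInstances false -- signatures carry both [IsDomain O] and [IsDiscreteValuationRing O] (Mathlib's class takes the former as a parameter)

namespace Summit.ResolutionOfSingularities.ResolutionOfSingularities.Cruxes.EquisingularLiftNat.Sections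

open MvPolynomial IsLocalRing Literature.AlgebraicGeometry.Resolution
open Summit.ResolutionOfSingularities.ResolutionOfSingularities.Theorems

universe u

/-! ## (Δ3) At most one bad residue class per point, for lifts `g + c·ϖ·h` with `h` a unit at the point -/

section BadResidue

variable {O : Type u} [CommRing O] [IsDomain O] [IsDiscreteValuationRing O] {ϖ : O}
variable {σ : Type u} [Finite σ]

/-- **(Δ3) At most one bad residue class.** `O` a DVR with uniformizer `ϖ`, `σ` finite, `A = O[x_σ]`, `g h ∈ A`,
`P ∋ ϖ` a prime of `A` with `h ∉ P`. Then the residues `c̄ ∈ O/ϖ` of the `c ∈ O` for which `g + c·ϖ·h ∈ 𝔪_P²`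
(in `A_P`) form a subsingleton: for two of them `(c₁ - c₂)·ϖ·h ∈ 𝔪_P²` with `c₁ - c₂` and `h` units of `A_P`, so
`ϖ ∈ 𝔪_P²`, contradicting `C_varpi_notMem_sq'`. (D1 (iii)'s inner step, with the multiplier `h`.) [folklore]
[OURS · L1 W4.5b] -/
theorem subsingleton_badResidue (hϖ : Irreducible ϖ) (g h : MvPolynomial σ O)
    (P : Ideal (MvPolynomial σ O)) [P.IsPrime] (hP : (C ϖ : MvPolynomial σ O) ∈ P) (hh : h ∉ P) :
    {r : O ⧸ Ideal.span {ϖ} | ∃ c : O, Ideal.Quotient.mk (Ideal.span {ϖ}) c = r ∧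
      algebraMap (MvPolynomial σ O) (Localization.AtPrime P) (g + C (c * ϖ) * h) ∈
        maximalIdeal (Localization.AtPrime P) ^ 2}.Subsingleton := by
  intro r₁ hr₁ r₂ hr₂
  obtain ⟨c₁, rfl, h₁⟩ := hr₁
  obtain ⟨c₂, rfl, h₂⟩ := hr₂
  by_contra hne
  -- `(c₁ - c₂)·h·ϖ ∈ 𝔪²`
  have hdiff := sub_mem h₁ h₂
  have e : g + C (c₁ * ϖ) * h - (g + C (c₂ * ϖ) * h) = C (c₁ - c₂) * h * C ϖ := by
    simp only [map_mul, map_sub]; ring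
  rw [← map_sub, e] at hdiff
  -- `c₁ - c₂` is a unit of `O`
  have hunit : IsUnit (c₁ - c₂) := by
    by_contra hnu
    apply hne
    have hmem : c₁ - c₂ ∈ maximalIdeal O := (IsLocalRing.mem_maximalIdeal _).mpr hnu
    rw [hϖ.maximalIdeal_eq] at hmem
    exact (Ideal.Quotient.eq).mpr hmem
  obtain ⟨v, hv⟩ := hunit
  -- `h` is a unit of `A_P`
  have hhunit : IsUnit (algebraMap (MvPolynomial σ O) (Localization.AtPrime P) h) :=
    (IsLocalization.AtPrime.isUnit_to_map_iff (Localization.AtPrime P) P h).mpr hh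
  obtain ⟨w, hw⟩ := hhunit
  have h3 := Ideal.mul_mem_left _
    (algebraMap (MvPolynomial σ O) (Localization.AtPrime P) (C ((v⁻¹ : Oˣ) : O)) *
      ((w⁻¹ : (Localization.AtPrime P)ˣ) : Localization.AtPrime P)) hdiff
  rw [map_mul, map_mul, ← hw, ← hv,
    show algebraMap (MvPolynomial σ O) (Localization.AtPrime P) (C ((v⁻¹ : Oˣ) : O)) *
        ((w⁻¹ : (Localization.AtPrime P)ˣ) : Localization.AtPrime P) *
        (algebraMap (MvPolynomial σ O) (Localization.AtPrime P) (C ((v : Oˣ) : O)) *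
          ((w : (Localization.AtPrime P)ˣ) : Localization.AtPrime P) *
          algebraMap (MvPolynomial σ O) (Localization.AtPrime P) (C ϖ)) =
      (algebraMap (MvPolynomial σ O) (Localization.AtPrime P) (C ((v⁻¹ : Oˣ) : O)) *
        algebraMap (MvPolynomial σ O) (Localization.AtPrime P) (C ((v : Oˣ) : O))) *
        (((w⁻¹ : (Localization.AtPrime P)ˣ) : Localization.AtPrime P) *
          ((w : (Localization.AtPrime P)ˣ) : Localization.AtPrime P)) *
        algebraMap (MvPolynomial σ O) (Localization.AtPrime P) (C ϖ) by ring,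
    ← map_mul, ← C_mul, Units.inv_mul, C_1, map_one, one_mul, Units.inv_mul, one_mul] at h3
  exact C_varpi_notMem_sq' hϖ P hP h3

end BadResidue

/-! ## (Δ4) Generic lifts with a multiplier: `A/(g + c·ϖ·h)` is regular along `ϖ` for almost every residue `c̄` -/

section Generic

variable {O : Type u} [CommRing O] [IsDomain O] [IsDiscreteValuationRing O] {ϖ : O}
variable {σ : Type u} [Finite σ]

/-- **(Δ4) Generic regularity of the lifts `g + c·ϖ·h` along the special fibre.** `O` a DVR with uniformizer
`ϖ`, `k = O/ϖ`, `σ` finite, `A = O[x_σ]`, `g h ∈ A`. Suppose the primes `𝔮 ∋ ḡ` of `k[x_σ]` at which `ḡ ∈ 𝔪_𝔮²`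
(the non-regular points of the trace `D = V(ḡ)`, generic points of multiple components included) are FINITELY
many, and that `h̄ ∉ 𝔮` for each of them. Then there is a finite set `S ⊂ k` of residues such that for every
`c ∈ O` with `c̄ ∉ S` the Δ-curve `A/(g + c·ϖ·h)` is a regular local ring at every prime containing `ϖ`.
Proof: at a prime `Q ∋ ϖ` over `P ⊂ A` and `𝔮 ⊂ k[x_σ]`: if `ḡ ∉ 𝔪_𝔮²` then `g + cϖh ∉ 𝔪_P²` for every `c`
(`notMem_sq_of_map_notMem_sq` along `A_P → k[x_σ]_𝔮`), else `h ∉ P` and `c̄` avoids the ≤ 1 bad residue of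
`P` (`subsingleton_badResidue`); conclude by Matsumura 14.2. `S` = the union of the bad residues over the
finitely many bad `𝔮`. [cite: Matsumura1987, Thm. 14.2] [OURS · L1 W4.5b] -/
theorem deltaRegularGeneric_mul (hϖ : Irreducible ϖ) (g h : MvPolynomial σ O)
    (hfin : {𝔮 : PrimeSpectrum (MvPolynomial σ (O ⧸ Ideal.span {ϖ})) |
      MvPolynomial.map (Ideal.Quotient.mk (Ideal.span {ϖ})) g ∈ 𝔮.asIdeal ∧
      algebraMap (MvPolynomial σ (O ⧸ Ideal.span {ϖ})) (Localization.AtPrime 𝔮.asIdeal)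
        (MvPolynomial.map (Ideal.Quotient.mk (Ideal.span {ϖ})) g) ∈
          maximalIdeal (Localization.AtPrime 𝔮.asIdeal) ^ 2}.Finite)
    (havoid : ∀ 𝔮 : PrimeSpectrum (MvPolynomial σ (O ⧸ Ideal.span {ϖ})),
      MvPolynomial.map (Ideal.Quotient.mk (Ideal.span {ϖ})) g ∈ 𝔮.asIdeal →
      algebraMap (MvPolynomial σ (O ⧸ Ideal.span {ϖ})) (Localization.AtPrime 𝔮.asIdeal)
        (MvPolynomial.map (Ideal.Quotient.mk (Ideal.span {ϖ})) g) ∈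
          maximalIdeal (Localization.AtPrime 𝔮.asIdeal) ^ 2 →
      MvPolynomial.map (Ideal.Quotient.mk (Ideal.span {ϖ})) h ∉ 𝔮.asIdeal) :
    ∃ S : Finset (O ⧸ Ideal.span {ϖ}), ∀ c : O, Ideal.Quotient.mk (Ideal.span {ϖ}) c ∉ S →
      letI A := MvPolynomial σ O
      letI I : Ideal A := Ideal.span {g + C (c * ϖ) * h}
      ∀ (Q : Ideal (A ⧸ I)) [Q.IsPrime], Ideal.Quotient.mk I (C ϖ : A) ∈ Q →
        IsRegularLocalRing (Localization.AtPrime Q) := by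
  classical
  haveI hmax : (Ideal.span {ϖ}).IsMaximal := PrincipalIdealRing.isMaximal_of_irreducible hϖ
  letI : Field (O ⧸ Ideal.span {ϖ}) := Ideal.Quotient.field _
  have hker : RingHom.ker (MvPolynomial.map (σ := σ) (Ideal.Quotient.mk (Ideal.span {ϖ}))) =
      Ideal.span {(C ϖ : MvPolynomial σ O)} := ker_map_mk_span_singleton ϖ
  have hsurj : Function.Surjective (MvPolynomial.map (σ := σ) (Ideal.Quotient.mk (Ideal.span {ϖ}))) :=
    MvPolynomial.map_surjective _ Ideal.Quotient.mk_surjective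
  have hredϖ : MvPolynomial.map (σ := σ) (Ideal.Quotient.mk (Ideal.span {ϖ})) (C ϖ) = 0 := by
    have h0 := map_mk_C_mul (σ := σ) 1 ϖ
    rwa [one_mul] at h0
  -- the excluded residues: the bad residues of the finitely many bad primes avoided by `h̄`
  have hEsub : ∀ 𝔮 : PrimeSpectrum (MvPolynomial σ (O ⧸ Ideal.span {ϖ})),
      MvPolynomial.map (Ideal.Quotient.mk (Ideal.span {ϖ})) h ∉ 𝔮.asIdeal →
      {r : O ⧸ Ideal.span {ϖ} | ∃ c : O, Ideal.Quotient.mk (Ideal.span {ϖ}) c = r ∧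
        algebraMap (MvPolynomial σ O) (Localization.AtPrime
          (𝔮.asIdeal.comap (MvPolynomial.map (σ := σ) (Ideal.Quotient.mk (Ideal.span {ϖ})))))
          (g + C (c * ϖ) * h) ∈ maximalIdeal _ ^ 2}.Subsingleton := by
    intro 𝔮 hh𝔮
    have hPϖ : (C ϖ : MvPolynomial σ O) ∈
        𝔮.asIdeal.comap (MvPolynomial.map (σ := σ) (Ideal.Quotient.mk (Ideal.span {ϖ}))) := by
      rw [Ideal.mem_comap, hredϖ]
      exact Ideal.zero_mem _
    have hhP : h ∉ 𝔮.asIdeal.comap (MvPolynomial.map (σ := σ) (Ideal.Quotient.mk (Ideal.span {ϖ}))) := by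
      rwa [Ideal.mem_comap]
    exact subsingleton_badResidue hϖ g h _ hPϖ hhP
  have hSfin := hfin.biUnion fun 𝔮 h𝔮 => (hEsub 𝔮 (havoid 𝔮 h𝔮.1 h𝔮.2)).finite
  refine ⟨hSfin.toFinset, fun c hc => ?_⟩
  intro Q _ hQϖ
  -- the prime `P = Q ∩ A ⊇ (g + cϖh, ϖ)` of `A` and its image `𝔮 ∋ ḡ` in `k[x_σ]`
  have hGP : g + C (c * ϖ) * h ∈ Q.comap (Ideal.Quotient.mk (Ideal.span {g + C (c * ϖ) * h})) := by
    rw [Ideal.mem_comap, Ideal.Quotient.eq_zero_iff_mem.mpr (Ideal.mem_span_singleton_self _)]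
    exact Q.zero_mem
  have hϖP : (C ϖ : MvPolynomial σ O) ∈ Q.comap (Ideal.Quotient.mk (Ideal.span {g + C (c * ϖ) * h})) := by
    rw [Ideal.mem_comap]; exact hQϖ
  have hgP : g ∈ Q.comap (Ideal.Quotient.mk (Ideal.span {g + C (c * ϖ) * h})) := by
    have h' := sub_mem hGP (Ideal.mul_mem_right h _ (Ideal.mul_mem_left _ (C c) hϖP))
    have e : g + C (c * ϖ) * h - C c * C ϖ * h = g := by rw [C_mul]; ring
    rwa [e] at h'
  have hkerP : RingHom.ker (MvPolynomial.map (σ := σ) (Ideal.Quotient.mk (Ideal.span {ϖ}))) ≤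
      Q.comap (Ideal.Quotient.mk (Ideal.span {g + C (c * ϖ) * h})) := by
    rw [hker, Ideal.span_singleton_le_iff_mem]; exact hϖP
  haveI h𝔮prime : ((Q.comap (Ideal.Quotient.mk (Ideal.span {g + C (c * ϖ) * h}))).map
      (MvPolynomial.map (σ := σ) (Ideal.Quotient.mk (Ideal.span {ϖ})))).IsPrime :=
    Ideal.map_isPrime_of_surjective hsurj hkerP
  let 𝔮 : PrimeSpectrum (MvPolynomial σ (O ⧸ Ideal.span {ϖ})) :=
    ⟨(Q.comap (Ideal.Quotient.mk (Ideal.span {g + C (c * ϖ) * h}))).map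
      (MvPolynomial.map (Ideal.Quotient.mk (Ideal.span {ϖ}))), h𝔮prime⟩
  have hcomapq : 𝔮.asIdeal.comap (MvPolynomial.map (σ := σ) (Ideal.Quotient.mk (Ideal.span {ϖ}))) =
      Q.comap (Ideal.Quotient.mk (Ideal.span {g + C (c * ϖ) * h})) := by
    change ((Q.comap (Ideal.Quotient.mk (Ideal.span {g + C (c * ϖ) * h}))).map _).comap _ = _
    rw [Ideal.comap_map_of_surjective _ hsurj, ← RingHom.ker_eq_comap_bot, sup_eq_left.mpr hkerP]
  have hgq : MvPolynomial.map (Ideal.Quotient.mk (Ideal.span {ϖ})) g ∈ 𝔮.asIdeal := Ideal.mem_map_of_mem _ hgP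
  by_cases hcase : algebraMap (MvPolynomial σ (O ⧸ Ideal.span {ϖ})) (Localization.AtPrime 𝔮.asIdeal)
      (MvPolynomial.map (Ideal.Quotient.mk (Ideal.span {ϖ})) g) ∈
        maximalIdeal (Localization.AtPrime 𝔮.asIdeal) ^ 2
  · -- bad prime: `h̄ ∉ 𝔮`, so at most one bad residue, which `c̄` avoids; conclude by Matsumura 14.2 in `A_P`
    haveI : IsRegularLocalRing (Localization.AtPrime
        (Q.comap (Ideal.Quotient.mk (Ideal.span {g + C (c * ϖ) * h})))) :=
      IsRegularRing.isRegularLocalRing_localization _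
    refine isRegularLocalRing_localization_quotient_of_notMem_sq Q ?_
    intro hG2
    apply hc
    rw [Set.Finite.mem_toFinset, Set.mem_iUnion₂]
    refine ⟨𝔮, ⟨hgq, hcase⟩, c, rfl, ?_⟩
    exact (mem_sq_maximalIdeal_localization_iff_of_eq hcomapq.symm _).mp hG2
  · -- good prime: the trace is regular at `𝔮`, so every lift is regular at `Q`
    refine isRegularLocalRing_localization_deltaCurve_of_notMem_sq_reduction Q 𝔮 hcomapq ?_
    rw [map_mk_add_C_mul_mul]
    exact hcase

end Generic

/-! ## (Δ4, plane curves) For `σ = Fin 2` and a reduced trace the finiteness is automatic -/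

section PlaneCurve

variable {O : Type} [CommRing O] [IsDomain O] [IsDiscreteValuationRing O] {ϖ : O}

/-- **(Δ4) for plane Δ-curves.** `O` a DVR with uniformizer `ϖ`, `k = O/ϖ`, `A = O[x, y]`, `g h ∈ A` with `ḡ ≠ 0`
SQUAREFREE (the trace `D = V(ḡ)` is a reduced plane curve, so its non-regular points are finitely many,
`finite_setOf_mem_sq` p501885) and `h̄` non-vanishing at every non-regular point of `D`. Then for all `c ∈ O` off
finitely many residue classes, `A/(g + c·ϖ·h)` is a regular local ring at every prime containing `ϖ`.
(`deltaRegularGeneric`, p502482, is the case `h = 1`; here the vertical term may carry a multiplier, as the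
dehomogenisations `ϖ·M(T)|_{T_j = 1}` of a projective lift do.) [cite: Matsumura1987, Thm. 14.2] [OURS · L1 W4.5b] -/
theorem deltaRegularGeneric_mul_fin_two (hϖ : Irreducible ϖ) (g h : MvPolynomial (Fin 2) O)
    (hg0 : MvPolynomial.map (Ideal.Quotient.mk (Ideal.span {ϖ})) g ≠ 0)
    (hsq : Squarefree (MvPolynomial.map (Ideal.Quotient.mk (Ideal.span {ϖ})) g))
    (havoid : ∀ 𝔮 : PrimeSpectrum (MvPolynomial (Fin 2) (O ⧸ Ideal.span {ϖ})),
      MvPolynomial.map (Ideal.Quotient.mk (Ideal.span {ϖ})) g ∈ 𝔮.asIdeal →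
      algebraMap (MvPolynomial (Fin 2) (O ⧸ Ideal.span {ϖ})) (Localization.AtPrime 𝔮.asIdeal)
        (MvPolynomial.map (Ideal.Quotient.mk (Ideal.span {ϖ})) g) ∈
          maximalIdeal (Localization.AtPrime 𝔮.asIdeal) ^ 2 →
      MvPolynomial.map (Ideal.Quotient.mk (Ideal.span {ϖ})) h ∉ 𝔮.asIdeal) :
    ∃ S : Finset (O ⧸ Ideal.span {ϖ}), ∀ c : O, Ideal.Quotient.mk (Ideal.span {ϖ}) c ∉ S →
      letI A := MvPolynomial (Fin 2) O
      letI I : Ideal A := Ideal.span {g + C (c * ϖ) * h}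
      ∀ (Q : Ideal (A ⧸ I)) [Q.IsPrime], Ideal.Quotient.mk I (C ϖ : A) ∈ Q →
        IsRegularLocalRing (Localization.AtPrime Q) := by
  haveI hmax : (Ideal.span {ϖ}).IsMaximal := PrincipalIdealRing.isMaximal_of_irreducible hϖ
  have hTfin := @finite_setOf_mem_sq (O ⧸ Ideal.span {ϖ}) (Ideal.Quotient.field _) _ hg0 hsq
  exact deltaRegularGeneric_mul hϖ g h hTfin havoid

end PlaneCurve

end Summit.ResolutionOfSingularities.ResolutionOfSingularities.Cruxes.EquisingularLiftNat.Sections
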